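import Summits.CriticalPhenomena.PercolationContinuityZ3.Theorems.PercNearOneGluingNoHeavyLowerTailFrontierDecRowsPinnedEdgeInduction
import HarnessLib

/-!
# The pinned-terminal schema with the FULL induction hypotheses: `E₃ ≥ 0` at ALL injective markings (and for a whole FAMILY of rows) under
# `w[e↦0]`, `w[e↦1]` is admissible when certifying the five-point forms at the chosen terminal

Support file (prover seat `prim-l12-p6`, gen 4; `--supports stmt-CriticalPhenomena-4575`).  No named facts, no sorries, no `native_decide`; bookkeeping
definitions `PinnedFamilyHyp` (the hypothesis package) and `UnmarkedEdgeHypAtAll` (its single-row form).  Sequel of `…FrontierDecRowsPinnedEdgeInduction`.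

WHY.  bnk-1's `UnmarkedEdgeHyp` / `UnmarkedEdgeHypAt i₀` hand the step only the two induction-hypothesis rows `T(μ⁰), T(μ¹) ≥ 0` AT THE SAME MARKING,
because the invariant `HasSpare` of their induction is not available at other markings.  Cloning at EVERY step of the induction (instead of once) removes
this restriction: the induction below is on the number of fractional pairs, simultaneously over all numbers of vertices, all rows of a family `r : ι` and all
injective markings; each step passes to the cloned graph (same `E₃`, `sahiE3_clone`; same number of fractional pairs, `card_frac_cloneWeight_le`; spares,
`hasSpare_clone`), re-marks there (`exists_remark_onto`, `exists_remark_off`) and expands the edge — and the induction hypothesis it can offer to the step is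
the FULL statement one level down: `0 ≤ E₃` for EVERY row of the family at EVERY injective marking, under both `w[e↦0]` and `w[e↦1]`.  For the five-point
certificate searches (prim-facecert, prim-l12-p1) this means: when certifying `B₁, B₂ ≥ 0` at the edge `(t,u)` of row `r`, every row `r'` of the family read
at ANY injective marking inside the five points `{a,b,c,y,u}` (120 markings) under `μ⁰` and under `μ¹` is an admissible induction-hypothesis row — e.g. for PATH
at the hub `a`: PATH at `(u,b,c,y)`, at `(a,u,c,y)`, … under `μ⁰`.

* `PinnedFamilyHyp Φ₁ Φ₂ Φ₃ i₀ m` — for pattern-predicate triples `(Φ₁ r, Φ₂ r, Φ₃ r)`, `r : ι`, with chosen terminals `i₀ r`: at dimension `m`, for every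
  `w`, `r`, injective `x`, unmarked `u`, `e = s(x (i₀ r), u)`: IF `0 ≤ E₃(row r' at x')` under `w[e↦0]` and `w[e↦1]` for ALL `r'` and ALL injective `x'`, THEN
  both polarised coefficients of row `r` at `x` along `e` are `≥ 0`.
* **`sahiE3_pev_nonneg_of_pinnedFamilyHyp`**: `Φ₁ r` pinned at `i₀ r`, `pev (Φ₂ r) x`, `pev (Φ₃ r) x` positively correlated (Harris), `∀ m, PinnedFamilyHyp … m`
  ⟹ `0 ≤ E₃(row r at x)` for every `n, w, r` and injective `x`.
* single row, group separations: `UnmarkedEdgeHypAtAll i₀` (= `UnmarkedEdgeHypAt i₀` with the all-markings induction hypotheses) and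
  **`sahiE3_sep_nonneg_of_unmarkedEdgeHypAtAll`** (pinned terminal = any singleton side, any slot); PATH for all markings from any one terminal type:
  `frontier_36_all_of_atAll`.
-/

noncomputable section

namespace Summit.CriticalPhenomena.PercolationContinuityZ3.Theorems

namespace TerminalEdgeInduction

open MeasureTheory Literature.Probability.Percolation Literature.Probability.LatticeModels
open EdgeInduction CovTransferCert E3GroupSepCert
open scoped Classical

variable {n k : ℕ}

/-! ### Cloning does not create fractional pairs -/

/-- The fractional pairs of the clone weights are images of fractional old pairs. [this work] -/
theorem frac_cloneWeight_subset (w : Sym2 (Fin n) → unitInterval) (x : Fin k → Fin n) :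
    frac (cloneWeight w x) ⊆ (frac w).image (Sym2.map (Fin.castAdd k)) := by
  intro f hf
  simp only [frac, Finset.mem_filter, Finset.mem_univ, true_and] at hf
  obtain ⟨hdiag, h0, h1⟩ := hf
  rw [Finset.mem_image]
  induction f using Sym2.ind with
  | h p q =>
    rcases castAdd_or_natAdd p with ⟨u, rfl⟩ | ⟨i, rfl⟩
    · rcases castAdd_or_natAdd q with ⟨v, rfl⟩ | ⟨j, rfl⟩
      · have hw : cloneWeight w x s(Fin.castAdd k u, Fin.castAdd k v) = w s(u, v) := by
          rw [← Sym2.map_mk, cloneWeight_map]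
        refine ⟨s(u, v), ?_, Sym2.map_mk _ _ _⟩
        simp only [frac, Finset.mem_filter, Finset.mem_univ, true_and]
        rw [hw] at h0 h1
        refine ⟨?_, h0, h1⟩
        rw [Sym2.mk_isDiag_iff] at hdiag ⊢
        exact fun h => hdiag (by rw [h])
      · exfalso
        rw [Sym2.eq_swap] at h0 h1
        by_cases hq : Fin.castAdd k u = Fin.castAdd k (x j)
        · rw [hq, cloneWeight_clone] at h1
          simp at h1
        · rw [cloneWeight_natAdd_of_ne w x j hq] at h0
          simp at h0
    · exfalso
      by_cases hq : q = Fin.castAdd k (x i)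
      · rw [hq, cloneWeight_clone] at h1
        simp at h1
      · rw [cloneWeight_natAdd_of_ne w x i hq] at h0
        simp at h0

/-- Cloning does not increase the number of fractional pairs. [this work] -/
theorem card_frac_cloneWeight_le (w : Sym2 (Fin n) → unitInterval) (x : Fin k → Fin n) :
    (frac (cloneWeight w x)).card ≤ (frac w).card :=
  (Finset.card_le_card (frac_cloneWeight_subset w x)).trans Finset.card_image_le

/-! ### The hypothesis package with all-markings, whole-family induction hypotheses -/

variable {ι : Type*}

/-- **Pinned-family hypotheses at dimension `m`.**  For a family of pattern-predicate triples `(Φ₁ r, Φ₂ r, Φ₃ r)` (`r : ι`) with chosen terminals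
`i₀ r`: for every weight function `w` on `Fin m`, every row `r`, every injective marking `x`, every UNMARKED vertex `u` — writing `e = s(x (i₀ r), u)` —
IF `0 ≤ E₃(pev (Φ₁ r') x', pev (Φ₂ r') x', pev (Φ₃ r') x')` under `prodBernoulli w[e↦0]` and under `prodBernoulli w[e↦1]` for ALL rows `r'` and ALL
injective markings `x'` (the full induction hypotheses), THEN the two polarised Bernstein coefficients of row `r` at `x` along `e` are nonnegative.
[this work] -/
def PinnedFamilyHyp (Φ₁ Φ₂ Φ₃ : ι → (Fin k → Fin k → Bool) → Bool) (i₀ : ι → Fin k) (m : ℕ) : Prop :=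
  ∀ (w : Sym2 (Fin m) → unitInterval) (r : ι) (x : Fin k → Fin m), Function.Injective x → ∀ (u : Fin m), (∀ j, x j ≠ u) →
    (∀ (r' : ι) (x' : Fin k → Fin m), Function.Injective x' →
        0 ≤ sahiE3 (prodBernoulli (Function.update w s(x (i₀ r), u) 0)) (pev (Φ₁ r') x') (pev (Φ₂ r') x') (pev (Φ₃ r') x') ∧
        0 ≤ sahiE3 (prodBernoulli (Function.update w s(x (i₀ r), u) 1)) (pev (Φ₁ r') x') (pev (Φ₂ r') x') (pev (Φ₃ r') x')) →
    0 ≤ polar₁ (prodBernoulli (Function.update w s(x (i₀ r), u) 0)) (prodBernoulli (Function.update w s(x (i₀ r), u) 1))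
        (pev (Φ₁ r) x) (pev (Φ₂ r) x) (pev (Φ₃ r) x) ∧
    0 ≤ polar₁ (prodBernoulli (Function.update w s(x (i₀ r), u) 1)) (prodBernoulli (Function.update w s(x (i₀ r), u) 0))
        (pev (Φ₁ r) x) (pev (Φ₂ r) x) (pev (Φ₃ r) x)

/-- **THE PINNED SCHEMA WITH FULL INDUCTION HYPOTHESES.**  For a family of pattern triples with `Φ₁ r` pinned at `i₀ r` and `pev (Φ₂ r) x`,
`pev (Φ₃ r) x` positively correlated under every `prodBernoulli`: if `PinnedFamilyHyp Φ₁ Φ₂ Φ₃ i₀ m` holds for every `m`, then `0 ≤ E₃(row r at x)` for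
every number of vertices, every weight function, every row `r` and every injective marking `x`.
Proof: induction on the number of fractional pairs, over all dimensions / rows / markings at once; each step clones (`sahiE3_clone`,
`card_frac_cloneWeight_le`, `hasSpare_clone`), re-marks (`exists_remark_onto`, `exists_remark_off`), expands (`sahiE3_oneBond`) — the induction
hypothesis one level down is the full statement, hence available at every marking and every row; no touching pair ⟹ `sahiE3_nonneg_of_not_touchAt`.
[this work] -/
theorem sahiE3_pev_nonneg_of_pinnedFamilyHyp (Φ₁ Φ₂ Φ₃ : ι → (Fin k → Fin k → Bool) → Bool) (i₀ : ι → Fin k)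
    (hΦ : ∀ r, PinnedPat (i₀ r) (Φ₁ r))
    (hcov : ∀ (r : ι) (m : ℕ) (w : Sym2 (Fin m) → unitInterval) (x : Fin k → Fin m),
      (prodBernoulli w).real (pev (Φ₂ r) x) * (prodBernoulli w).real (pev (Φ₃ r) x) ≤ (prodBernoulli w).real (pev (Φ₂ r) x ∩ pev (Φ₃ r) x))
    (h : ∀ m : ℕ, PinnedFamilyHyp Φ₁ Φ₂ Φ₃ i₀ m)
    (w : Sym2 (Fin n) → unitInterval) (r : ι) (x : Fin k → Fin n) (hx : Function.Injective x) :
    0 ≤ sahiE3 (prodBernoulli w) (pev (Φ₁ r) x) (pev (Φ₂ r) x) (pev (Φ₃ r) x) := by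
  suffices H : ∀ (M : ℕ) (n : ℕ) (w : Sym2 (Fin n) → unitInterval), (frac w).card ≤ M →
      ∀ (r : ι) (x : Fin k → Fin n), Function.Injective x → 0 ≤ sahiE3 (prodBernoulli w) (pev (Φ₁ r) x) (pev (Φ₂ r) x) (pev (Φ₃ r) x) from
    H _ n w le_rfl r x hx
  intro M
  induction M with
  | zero =>
      intro n w hM r x _
      have hB : ¬ TouchAt w x (i₀ r) := by
        rintro ⟨z, u, -, hzu, h0, h1⟩
        have := Finset.card_pos.2 ⟨_, mem_frac hzu h0 h1⟩
        omega
      exact sahiE3_nonneg_of_not_touchAt (E₁ := fun x => pev (Φ₁ r) x) (E₂ := fun x => pev (Φ₂ r) x) (E₃ := fun x => pev (Φ₃ r) x)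
        (isPinnedAt_pev (hΦ r)) w x (hcov r n w x) hB
  | succ M ih =>
      intro n w hM r x hx
      -- pass to the cloned graph (same `E₃`, no new fractional pairs, spares)
      rw [← sahiE3_clone w x (Φ₁ r) (Φ₂ r) (Φ₃ r)]
      have hX : Function.Injective (Fin.castAdd k ∘ x) := (Fin.castAdd_injective n k).comp hx
      have hS : HasSpare (cloneWeight w x) (Fin.castAdd k ∘ x) := hasSpare_clone w x
      have hcW : (frac (cloneWeight w x)).card ≤ M + 1 := (card_frac_cloneWeight_le w x).trans hM
      by_cases hB : TouchAt (cloneWeight w x) (Fin.castAdd k ∘ x) (i₀ r)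
      · obtain ⟨z, u, hiz, hzu, h0, h1⟩ := hB
        obtain ⟨X₁, hX₁, hS₁, hz₁, hT₁⟩ := exists_remark_onto (E₁ := fun x => pev (Φ₁ r) x) (E₂ := fun x => pev (Φ₂ r) x)
          (E₃ := fun x => pev (Φ₃ r) x) (isLocal_pev _) (isLocal_pev _) (isLocal_pev _) (cloneWeight w x) hX hS (i₀ r) hiz
        obtain ⟨X₂, hX₂, -, hz₂, hu₂, hT₂⟩ := exists_remark_off (E₁ := fun x => pev (Φ₁ r) x) (E₂ := fun x => pev (Φ₂ r) x)
          (E₃ := fun x => pev (Φ₃ r) x) (isLocal_pev _) (isLocal_pev _) (isLocal_pev _) (cloneWeight w x) hX₁ hS₁ (i₀ r) (u := u)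
          (by rw [hz₁]; exact hzu)
        rw [← hT₁, ← hT₂]
        have hzu' : X₂ (i₀ r) ≠ u := by rw [hz₂, hz₁]; exact hzu
        have h0' : (0 : ℝ) < cloneWeight w x s(X₂ (i₀ r), u) := by rw [hz₂, hz₁]; exact h0
        have h1' : (cloneWeight w x s(X₂ (i₀ r), u) : ℝ) < 1 := by rw [hz₂, hz₁]; exact h1
        have he : s(X₂ (i₀ r), u) ∈ frac (cloneWeight w x) := mem_frac hzu' h0' h1'
        have hc0 : (frac (Function.update (cloneWeight w x) s(X₂ (i₀ r), u) 0)).card ≤ M :=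
          Nat.lt_succ_iff.1 (lt_of_lt_of_le (card_frac_update_lt _ he 0 (Or.inl rfl)) hcW)
        have hc1 : (frac (Function.update (cloneWeight w x) s(X₂ (i₀ r), u) 1)).card ≤ M :=
          Nat.lt_succ_iff.1 (lt_of_lt_of_le (card_frac_update_lt _ he 1 (Or.inr rfl)) hcW)
        have i0 := ih _ _ hc0 r X₂ hX₂
        have i1 := ih _ _ hc1 r X₂ hX₂
        obtain ⟨b1, b2⟩ := h (n + k) (cloneWeight w x) r X₂ hX₂ u hu₂
          (fun r' x' hx' => ⟨ih _ _ hc0 r' x' hx', ih _ _ hc1 r' x' hx'⟩)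
        have hp0 : (0 : ℝ) ≤ cloneWeight w x s(X₂ (i₀ r), u) := (cloneWeight w x s(X₂ (i₀ r), u)).2.1
        have hp1 : (cloneWeight w x s(X₂ (i₀ r), u) : ℝ) ≤ 1 := (cloneWeight w x s(X₂ (i₀ r), u)).2.2
        have hq : (0 : ℝ) ≤ 1 - cloneWeight w x s(X₂ (i₀ r), u) := sub_nonneg.2 hp1
        rw [sahiE3_oneBond (cloneWeight w x) s(X₂ (i₀ r), u)]
        positivity
      · exact sahiE3_nonneg_of_not_touchAt (E₁ := fun x => pev (Φ₁ r) x) (E₂ := fun x => pev (Φ₂ r) x) (E₃ := fun x => pev (Φ₃ r) x)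
          (isPinnedAt_pev (hΦ r)) (cloneWeight w x) (Fin.castAdd k ∘ x) (hcov r _ _ _) hB

/-! ### Single row of group separations, all-markings induction hypotheses -/

/-- **The unmarked-edge hypotheses at the terminal `i₀` with ALL-MARKINGS induction hypotheses** (single row): as `UnmarkedEdgeHypAt i₀`, but the
step at `(x, u)` may use `0 ≤ E₃(E₁ x', E₂ x', E₃ x')` under `w[e↦0]` and `w[e↦1]` for EVERY injective marking `x'` (not only `x' = x`). [this work] -/
def UnmarkedEdgeHypAtAll (i₀ : Fin k) (E₁ E₂ E₃ : (Fin k → Fin n) → Set (BondConfig (Fin n))) : Prop :=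
  ∀ (w : Sym2 (Fin n) → unitInterval) (x : Fin k → Fin n), Function.Injective x → ∀ (u : Fin n), (∀ j, x j ≠ u) →
    (∀ x' : Fin k → Fin n, Function.Injective x' →
        0 ≤ sahiE3 (prodBernoulli (Function.update w s(x i₀, u) 0)) (E₁ x') (E₂ x') (E₃ x') ∧
        0 ≤ sahiE3 (prodBernoulli (Function.update w s(x i₀, u) 1)) (E₁ x') (E₂ x') (E₃ x')) →
    0 ≤ polar₁ (prodBernoulli (Function.update w s(x i₀, u) 0)) (prodBernoulli (Function.update w s(x i₀, u) 1))
        (E₁ x) (E₂ x) (E₃ x) ∧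
    0 ≤ polar₁ (prodBernoulli (Function.update w s(x i₀, u) 1)) (prodBernoulli (Function.update w s(x i₀, u) 0))
        (E₁ x) (E₂ x) (E₃ x)

variable {E₁ E₂ E₃ : (Fin k → Fin n) → Set (BondConfig (Fin n))}

/-- `UnmarkedEdgeHypAt i₀` (same-marking induction hypotheses) implies `UnmarkedEdgeHypAtAll i₀`. [this work] -/
theorem UnmarkedEdgeHypAt.toAll {i₀ : Fin k} (h : UnmarkedEdgeHypAt i₀ E₁ E₂ E₃) : UnmarkedEdgeHypAtAll i₀ E₁ E₂ E₃ :=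
  fun w x hx u hu IH => h w x hx u hu (IH x hx).1 (IH x hx).2

/-- Slot swap `1 ↔ 2` for the all-markings hypotheses. [this work] -/
theorem UnmarkedEdgeHypAtAll.swap₁₂ {i₀ : Fin k} (h : UnmarkedEdgeHypAtAll i₀ E₁ E₂ E₃) : UnmarkedEdgeHypAtAll i₀ E₂ E₁ E₃ := by
  intro w x hx u hu IH
  have H := h w x hx u hu (fun x' hx' => by
    rw [sahiE3_comm₁₂ _ (E₁ x') (E₂ x') (E₃ x'), sahiE3_comm₁₂ _ (E₁ x') (E₂ x') (E₃ x')]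
    exact IH x' hx')
  rw [polar₁_swap₁₂ _ _ (E₂ x) (E₁ x) (E₃ x), polar₁_swap₁₂ _ _ (E₂ x) (E₁ x) (E₃ x)] at H
  exact H

/-- Slot swap `2 ↔ 3` for the all-markings hypotheses. [this work] -/
theorem UnmarkedEdgeHypAtAll.swap₂₃ {i₀ : Fin k} (h : UnmarkedEdgeHypAtAll i₀ E₁ E₂ E₃) : UnmarkedEdgeHypAtAll i₀ E₁ E₃ E₂ := by
  intro w x hx u hu IH
  have H := h w x hx u hu (fun x' hx' => by
    rw [sahiE3_comm₂₃ _ (E₁ x') (E₂ x') (E₃ x'), sahiE3_comm₂₃ _ (E₁ x') (E₂ x') (E₃ x')]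
    exact IH x' hx')
  rw [← polar₁_swap₂₃ _ _ (E₁ x) (E₂ x) (E₃ x), ← polar₁_swap₂₃ _ _ (E₁ x) (E₂ x) (E₃ x)] at H
  exact H

/-- The single-row sep form with the first separation pinned (`I₁ = [i₀]` or `J₁ = [i₀]`). [this work] -/
theorem sahiE3_sep_nonneg_of_unmarkedEdgeHypAtAll_first (i₀ : Fin k) (I₁ J₁ I₂ J₂ I₃ J₃ : List (Fin k)) (hpin : I₁ = [i₀] ∨ J₁ = [i₀])
    (h : ∀ m : ℕ, UnmarkedEdgeHypAtAll i₀ (fun x : Fin k → Fin m => connEvent (sep (I₁.map x) (J₁.map x)))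
      (fun x => connEvent (sep (I₂.map x) (J₂.map x))) (fun x => connEvent (sep (I₃.map x) (J₃.map x))))
    (w : Sym2 (Fin n) → unitInterval) (x : Fin k → Fin n) (hx : Function.Injective x) :
    0 ≤ sahiE3 (prodBernoulli w) (connEvent (sep (I₁.map x) (J₁.map x))) (connEvent (sep (I₂.map x) (J₂.map x)))
      (connEvent (sep (I₃.map x) (J₃.map x))) := by
  have hΦ : PinnedPat i₀ (sepPat I₁ J₁) := by
    rcases hpin with rfl | rfl
    · exact pinnedPat_sepPat_left i₀ J₁
    · exact pinnedPat_sepPat_right i₀ I₁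
  rw [← pev_sepPat, ← pev_sepPat, ← pev_sepPat]
  refine sahiE3_pev_nonneg_of_pinnedFamilyHyp (ι := Unit) (fun _ => sepPat I₁ J₁) (fun _ => sepPat I₂ J₂) (fun _ => sepPat I₃ J₃) (fun _ => i₀)
    (fun _ => hΦ) (fun _ m w' x' => ?_) (fun m => ?_) w () x hx
  · rw [pev_sepPat, pev_sepPat]; exact real_mul_le_inter_sep w' _ _ _ _
  · intro w' _ x' hx' u hu IH
    simp only [pev_sepPat] at IH ⊢
    exact h m w' x' hx' u hu (fun x'' hx'' => IH () x'' hx'')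

/-- **Single row of group separations, pinned at one terminal, ALL-MARKINGS induction hypotheses.**  For three group separations one of whose six
sides is the single terminal `i₀`: if for every number of vertices the forms at `i₀` are nonnegative given `0 ≤ E₃` at ALL injective markings under
`w[e↦0]`, `w[e↦1]` (`UnmarkedEdgeHypAtAll i₀`), then `0 ≤ E₃` at every injective marking of every finite weighted graph. [this work] -/
theorem sahiE3_sep_nonneg_of_unmarkedEdgeHypAtAll (i₀ : Fin k) (I₁ J₁ I₂ J₂ I₃ J₃ : List (Fin k))
    (hpin : I₁ = [i₀] ∨ J₁ = [i₀] ∨ I₂ = [i₀] ∨ J₂ = [i₀] ∨ I₃ = [i₀] ∨ J₃ = [i₀])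
    (h : ∀ m : ℕ, UnmarkedEdgeHypAtAll i₀ (fun x : Fin k → Fin m => connEvent (sep (I₁.map x) (J₁.map x)))
      (fun x => connEvent (sep (I₂.map x) (J₂.map x))) (fun x => connEvent (sep (I₃.map x) (J₃.map x))))
    (w : Sym2 (Fin n) → unitInterval) (x : Fin k → Fin n) (hx : Function.Injective x) :
    0 ≤ sahiE3 (prodBernoulli w) (connEvent (sep (I₁.map x) (J₁.map x))) (connEvent (sep (I₂.map x) (J₂.map x)))
      (connEvent (sep (I₃.map x) (J₃.map x))) := by
  rcases hpin with h1 | h1 | h2 | h2 | h3 | h3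
  · exact sahiE3_sep_nonneg_of_unmarkedEdgeHypAtAll_first i₀ I₁ J₁ I₂ J₂ I₃ J₃ (Or.inl h1) h w x hx
  · exact sahiE3_sep_nonneg_of_unmarkedEdgeHypAtAll_first i₀ I₁ J₁ I₂ J₂ I₃ J₃ (Or.inr h1) h w x hx
  · rw [sahiE3_comm₁₂]
    exact sahiE3_sep_nonneg_of_unmarkedEdgeHypAtAll_first i₀ I₂ J₂ I₁ J₁ I₃ J₃ (Or.inl h2) (fun m => (h m).swap₁₂) w x hx
  · rw [sahiE3_comm₁₂]
    exact sahiE3_sep_nonneg_of_unmarkedEdgeHypAtAll_first i₀ I₂ J₂ I₁ J₁ I₃ J₃ (Or.inr h2) (fun m => (h m).swap₁₂) w x hx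
  · rw [sahiE3_comm₂₃, sahiE3_comm₁₂]
    exact sahiE3_sep_nonneg_of_unmarkedEdgeHypAtAll_first i₀ I₃ J₃ I₁ J₁ I₂ J₂ (Or.inl h3) (fun m => (h m).swap₂₃.swap₁₂) w x hx
  · rw [sahiE3_comm₂₃, sahiE3_comm₁₂]
    exact sahiE3_sep_nonneg_of_unmarkedEdgeHypAtAll_first i₀ I₃ J₃ I₁ J₁ I₂ J₂ (Or.inr h3) (fun m => (h m).swap₂₃.swap₁₂) w x hx

/-- **PATH (row 36) on every finite weighted graph from the forms at ANY ONE terminal, with all-markings induction hypotheses** — all markings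
(degenerate ones as in `frontier_36_all_of_at`). [this work] -/
theorem frontier_36_all_of_atAll (i₀ : Fin 4)
    (h : ∀ m : ℕ, UnmarkedEdgeHypAtAll i₀ (fun x : Fin 4 → Fin m => connEvent (FrontierDecRows.row 36 m (x 0, x 1, x 2, x 3)).1)
      (fun x => connEvent (FrontierDecRows.row 36 m (x 0, x 1, x 2, x 3)).2.1)
      (fun x => connEvent (FrontierDecRows.row 36 m (x 0, x 1, x 2, x 3)).2.2))
    (w : Sym2 (Fin n) → unitInterval) (a b c y : Fin n) :
    0 ≤ sahiE3 (prodBernoulli w) (connEvent (FrontierDecRows.row 36 n (a, b, c, y)).1)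
      (connEvent (FrontierDecRows.row 36 n (a, b, c, y)).2.1) (connEvent (FrontierDecRows.row 36 n (a, b, c, y)).2.2) := by
  have hpin : [0] = [i₀] ∨ [1] = [i₀] ∨ [0] = [i₀] ∨ [2] = [i₀] ∨ [1] = [i₀] ∨ [3] = [i₀] := by
    fin_cases i₀ <;> decide
  have hr : FrontierDecRows.row 36 n (a, b, c, y) = (sep [a] [b], sep [a] [c], sep [b] [y]) := rfl
  rw [hr]
  dsimp only
  by_cases hab : a = b
  · subst hab; exact le_of_eq (sahiE3_sep_eq_zero_left (v := a) (by simp) (by simp) _ _).symm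
  by_cases hac : a = c
  · subst hac; exact le_of_eq (sahiE3_sep_eq_zero_mid (v := a) (by simp) (by simp) _ _).symm
  by_cases hby : b = y
  · subst hby; exact le_of_eq (sahiE3_sep_eq_zero_right (v := b) (by simp) (by simp) _ _).symm
  by_cases hay : a = y
  · subst hay
    rw [connEvent_sep_comm [b] [a]]
    exact sahiE3_nonneg_of_repeat₁₃ w (isLowerSet_connEvent_sep _ _) (isLowerSet_connEvent_sep _ _)
  by_cases hbc : b = c
  · subst hbc
    exact sahiE3_nonneg_of_repeat₁₂ w (isLowerSet_connEvent_sep _ _) (isLowerSet_connEvent_sep _ _)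
  by_cases hcy : c = y
  · subst hcy
    rw [connEvent_sep_one_one, connEvent_sep_one_one, connEvent_sep_one_one]
    exact ThreePointLB.sahiE3_pairSep_nonneg w a b c
  exact sahiE3_sep_nonneg_of_unmarkedEdgeHypAtAll i₀ [0] [1] [0] [2] [1] [3] hpin h w ![a, b, c, y]
    (injective_vec4 hab hac hay hbc hby hcy)

end TerminalEdgeInduction

end Summit.CriticalPhenomena.PercolationContinuityZ3.Theorems
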